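import Mathlib.Algebra.Group.Irreducible.Indecomposable
import Mathlib.LinearAlgebra.RootSystem.Reduced
import HarnessLib

/-!
# Positive and simple roots of a finite root pairing over `ℤ` relative to a regular coweight
(trunk T-AUTOMORPHIC, G25 AutomorphicL; combinatorial input of the Lie-algebra isomorphism theorem)

For a finite root pairing `P : RootPairing ι ℤ X Y` (a root datum) and a coweight `y ∈ Y` on which
no root vanishes (such `y` exist, `RootPairing.exists_forall_root'_ne_zero` in
`BigCellReduction.lean`, not imported here) the roots split into the `y`-positive and
`y`-negative ones, and the *simple roots* are the `y`-positive roots that are not the sum of two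
`y`-positive roots (Serre, *Complex semisimple Lie algebras*, V §9; Humphreys, *Introduction to
Lie algebras and representation theory*, §10.1–10.2). This file is a thin layer over Mathlib's
`IsAddIndecomposable.baseOf` for the **specific** form `x ↦ ⟨x, y⟩` of the coweight `y`
(`simpleRoots P y = IsAddIndecomposable.baseOf P.root (coweightForm P y)`), recording exactly what
the Lie-algebra isomorphism theorem (DAG of `chevalley_isomorphism`) consumes — **without** any
reducedness hypothesis `P.IsReduced` and **without** linear independence of the simple roots:

* `simpleRoots P y` (definition) with `coweightForm_pos_of_mem_simpleRoots`;
* `root_sub_root_notMem_of_mem_simpleRoots` — the difference of two distinct simple roots is not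
  a root (so `[e_α, f_β] = 0` for distinct simple `α, β`);
* `root_mem_closure_simpleRoots` — every positive root lies in the additive monoid generated by
  the simple roots; `coweightForm_pos_of_mem_closure` — non-zero elements of that monoid are
  `y`-positive;
* `exists_eq_add_of_pos_of_notMem` — a positive non-simple root is the sum of two positive roots,
  whence the induction principle `pos_root_induction` (used to show that the simple root vectors
  generate the semisimple part of the Lie algebra);
* `mem_simpleRoots_neg_iff` — the simple roots for `-y` are the negatives of those for `y`;
* **`exists_mem_forall_add_notMem`** — the combinatorial heart of the component-free form of
  Humphreys' proof of the isomorphism theorem 14.2: a non-empty set `C` of roots closed under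
  `⟨α_j, α_i^∨⟩ ≠ 0, i ∈ C ⇒ j ∈ C` contains a root `β` with `β + α ∉ R` for every simple `α`
  (take `β ∈ C` with `⟨β, y⟩` maximal; the only escape would force `⟨β, α^∨⟩ ⟨α, β^∨⟩ = 4`, i.e.
  `β = -α` by Mathlib's `RootPairing.coxeterWeight_eq_four_iff_not_linearIndependent`, against
  positivity of `α ∈ C`).

Relation to the tree and to Mathlib. Mathlib's `RootPairing.Base` (over any commutative ring,
hence over `ℤ`) provides `Base.sub_notMem_range_root`, `Base.IsPos`, `Base.height` and the
induction principles `Base.IsPos.induction_on_add` / `Base.induction_add`, the latter under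
`[P.IsReduced]`; and this trunk already has `RootPairing.nonempty_base_int`
(`IsomorphismTheoremUniqueProofs.lean`), which builds a `ℤ`-`Base` of a *reduced* `P` from
`IsAddIndecomposable.baseOf P.root f` for a generic integral form `f` (root half by
`RootPairing.linearIndepOn_root_baseOf'`, coroot half by a polarization argument). The present file
is deliberately weaker and cheaper: it fixes the positive system of a *given* regular coweight `y`
(the one the consumer works with), never needs `IsReduced` (reducedness of the root datum of a
reductive group is itself proved downstream, `RootStrings.lean`, in characteristic `0`) nor linear
independence or the coroot half, and adds the maximal-root lemma `exists_mem_forall_add_notMem`,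
which has no counterpart in Mathlib or in the tree.

## Mathlib

`IsAddIndecomposable.baseOf`, `AddSubmonoid.closure_image_isAddIndecomposable_baseOf`,
`IsAddIndecomposable.pairwise_baseOf_sub_notMem`, `IsAddIndecomposable.image_baseOf_neg_comp_eq`,
`RootPairing.indexNeg`, `RootPairing.coxeterWeight_eq_four_iff_not_linearIndependent`,
`RootPairing.pairing_smul_root_eq_of_not_linearIndependent`; see the previous paragraph for
`RootPairing.Base`. Nothing here duplicates a Mathlib or Literature declaration (searched `baseOf`,
`simpleRoots`, `coweightForm`, `IsPos`).

## References

* J.-P. Serre, *Complex semisimple Lie algebras*, Ch. V §9 (Lemmas 2, 3).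
* J. E. Humphreys, *Introduction to Lie algebras and representation theory*, GTM 9, §10.1–10.2,
  §14.2.
* [SpringerLAG1998] T. A. Springer, *Linear Algebraic Groups*, 2nd ed. (1998), 7.4.5 (systems of
  positive roots defined by a regular coweight).
-/

open Set Function

namespace Literature.NumberTheory.Automorphic

variable {ι X Y : Type*} [AddCommGroup X] [AddCommGroup Y] (P : RootPairing ι ℤ X Y)

/-! ### The linear form of a coweight and the simple roots -/

/-- The additive form `x ↦ ⟨x, y⟩` on the weight lattice defined by a coweight `y`. [folklore] -/
def coweightForm (y : Y) : X →+ ℤ := (P.toLinearMap.flip y).toAddMonoidHom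

/-- `coweightForm P y x = ⟨x, y⟩`. [folklore] -/
@[simp] lemma coweightForm_apply (y : Y) (x : X) : coweightForm P y x = P.toLinearMap x y := rfl

/-- On a root, `coweightForm P y` is `P.root' i y`. [folklore] -/
lemma coweightForm_root (y : Y) (i : ι) : coweightForm P y (P.root i) = P.root' i y := rfl

/-- `coweightForm P (-y) = -coweightForm P y`. [folklore] -/
@[simp] lemma coweightForm_neg (y : Y) : coweightForm P (-y) = -coweightForm P y := by
  ext x; simp [coweightForm]

/-- The *simple roots* of `P` with respect to the coweight `y`: the `y`-positive roots which are
not the sum of two `y`-positive roots (Mathlib's `IsAddIndecomposable.baseOf`; Serre V §9,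
Humphreys §10.1). [folklore] -/
def simpleRoots (y : Y) : Set ι := IsAddIndecomposable.baseOf P.root (coweightForm P y)

variable {P}

/-- Unfolding of `simpleRoots`. [folklore] -/
lemma mem_simpleRoots_iff {y : Y} {i : ι} :
    i ∈ simpleRoots P y ↔
      IsAddIndecomposable P.root {j | 0 < coweightForm P y (P.root j)} i := Iff.rfl

/-- Simple roots are positive. [folklore] -/
theorem coweightForm_pos_of_mem_simpleRoots {y : Y} {i : ι} (hi : i ∈ simpleRoots P y) :
    0 < P.root' i y :=
  IsAddIndecomposable.baseOf_subset_pos P.root (coweightForm P y) hi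

/-- With the involution `-i = s_i(i)` of the index type (`RootPairing.indexNeg`),
`P.root (-i) = -P.root i`. [folklore] -/
lemma root_indexNeg (i : ι) :
    letI := P.indexNeg
    P.root (-i) = -P.root i := by
  simp

/-- **The difference of two distinct simple roots is not a root** (Serre V §9 Lemma 3; Humphreys
10.1 Lemma). [folklore] -/
theorem root_sub_root_notMem_of_mem_simpleRoots {y : Y} (hy : ∀ i, P.root' i y ≠ 0) {i j : ι}
    (hi : i ∈ simpleRoots P y) (hj : j ∈ simpleRoots P y) (hij : i ≠ j) :
    P.root i - P.root j ∉ range P.root := by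
  letI := P.indexNeg
  have h := IsAddIndecomposable.pairwise_baseOf_sub_notMem P.root (fun i => root_indexNeg i)
    (coweightForm P y) (fun i => hy i)
  exact h hi hj hij

/-- **Every positive root is a sum of simple roots**: it lies in the additive monoid generated by
the simple roots (Serre V §9 Lemma 2). [folklore] -/
theorem root_mem_closure_simpleRoots [Finite ι] {y : Y} {i : ι} (hi : 0 < P.root' i y) :
    P.root i ∈ AddSubmonoid.closure (P.root '' simpleRoots P y) := by
  rw [simpleRoots, AddSubmonoid.closure_image_isAddIndecomposable_baseOf]
  exact AddSubmonoid.subset_closure ⟨i, hi, rfl⟩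

/-- Elements of the monoid generated by the simple roots are `0` or `y`-positive. [folklore] -/
theorem coweightForm_nonneg_of_mem_closure {y : Y} {x : X}
    (hx : x ∈ AddSubmonoid.closure (P.root '' simpleRoots P y)) :
    x = 0 ∨ 0 < coweightForm P y x := by
  induction hx using AddSubmonoid.closure_induction with
  | mem x hx =>
    obtain ⟨i, hi, rfl⟩ := hx
    exact Or.inr (coweightForm_pos_of_mem_simpleRoots hi)
  | zero => exact Or.inl rfl
  | add a b _ _ ha hb =>
    rcases ha with rfl | ha
    · simpa using hb
    rcases hb with rfl | hb
    · exact Or.inr (by simpa using ha)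
    · exact Or.inr (by rw [map_add]; exact add_pos ha hb)

/-- A non-zero element of the monoid generated by the simple roots is `y`-positive; in particular
`β - (α₁ + ⋯ + αₘ) ≠ β` for simple `αᵢ`, `m ≥ 1`. [folklore] -/
theorem coweightForm_pos_of_mem_closure {y : Y} {x : X}
    (hx : x ∈ AddSubmonoid.closure (P.root '' simpleRoots P y)) (hx0 : x ≠ 0) :
    0 < coweightForm P y x :=
  (coweightForm_nonneg_of_mem_closure hx).resolve_left hx0

/-- A positive root which is not simple is the sum of two positive roots (the definition of
indecomposability, negated). [folklore] -/
theorem exists_eq_add_of_pos_of_notMem {y : Y} {i : ι} (hi : 0 < P.root' i y)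
    (hni : i ∉ simpleRoots P y) :
    ∃ j l : ι, P.root i = P.root j + P.root l ∧ 0 < P.root' j y ∧ 0 < P.root' l y := by
  simp only [mem_simpleRoots_iff, IsAddIndecomposable, mem_setOf_eq, coweightForm_apply,
    not_and, not_forall, exists_prop] at hni
  obtain ⟨j, hj, l, hl, hjl, hne⟩ := hni hi
  exact ⟨j, l, hjl, hj, hl⟩

/-- **Induction on positive roots**: a property of the simple roots which passes to a positive
root `α = β + γ` from positive roots `β, γ` having it, holds for all positive roots (induction on
`⟨α, y⟩`). [folklore] -/
theorem pos_root_induction {y : Y} {p : ι → Prop}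
    (hs : ∀ i ∈ simpleRoots P y, p i)
    (hadd : ∀ i j l, P.root i = P.root j + P.root l → 0 < P.root' j y → 0 < P.root' l y →
      p j → p l → p i)
    {i : ι} (hi : 0 < P.root' i y) : p i := by
  -- strong induction on the natural number `⟨α_i, y⟩`
  suffices h : ∀ n : ℕ, ∀ i, P.root' i y = n → 0 < P.root' i y → p i by
    exact h (P.root' i y).toNat i (Int.toNat_of_nonneg hi.le).symm hi
  intro n
  induction n using Nat.strong_induction_on with
  | _ n ih =>
    intro i hin hipos
    by_cases hmem : i ∈ simpleRoots P y
    · exact hs i hmem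
    obtain ⟨j, l, hjl, hj, hl⟩ := exists_eq_add_of_pos_of_notMem hipos hmem
    have hsum : P.root' i y = P.root' j y + P.root' l y := by
      change P.toLinearMap (P.root i) y = P.toLinearMap (P.root j) y + P.toLinearMap (P.root l) y
      rw [hjl, map_add, LinearMap.add_apply]
    have hjn : (P.root' j y).toNat < n := by
      have : P.root' j y < n := by rw [← hin, hsum]; exact lt_add_of_pos_right _ hl
      omega
    have hln : (P.root' l y).toNat < n := by
      have : P.root' l y < n := by rw [← hin, hsum]; exact lt_add_of_pos_left _ hj
      omega
    exact hadd i j l hjl hj hl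
      (ih _ hjn j (Int.toNat_of_nonneg hj.le).symm hj)
      (ih _ hln l (Int.toNat_of_nonneg hl.le).symm hl)

/-- **The simple roots for `-y` are the negatives of the simple roots for `y`.** [folklore] -/
theorem mem_simpleRoots_neg_iff {y : Y} {i : ι} :
    letI := P.indexNeg
    i ∈ simpleRoots P (-y) ↔ -i ∈ simpleRoots P y := by
  letI := P.indexNeg
  have key := IsAddIndecomposable.image_baseOf_neg_comp_eq P.root (fun i => root_indexNeg i)
    (coweightForm P y)
  -- `negAddMonoidHom.comp (coweightForm P y) = coweightForm P (-y)`
  have hcomp : negAddMonoidHom.comp (coweightForm P y) = coweightForm P (-y) := by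
    ext x; simp
  rw [hcomp] at key
  constructor
  · intro hi
    have hmem : P.root i ∈ P.root '' IsAddIndecomposable.baseOf P.root (coweightForm P (-y)) :=
      ⟨i, hi, rfl⟩
    rw [key] at hmem
    obtain ⟨j, hj, hji⟩ := hmem
    have hji' : P.root j = P.root (-i) := by
      rw [root_indexNeg]
      have : -P.root j = P.root i := hji
      rw [← this, neg_neg]
    rw [P.root.injective hji'] at hj
    exact hj
  · intro hi
    have hmem : (negAddMonoidHom ∘ P.root) (-i) ∈
        (negAddMonoidHom ∘ P.root) '' IsAddIndecomposable.baseOf P.root (coweightForm P y) :=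
      ⟨-i, hi, rfl⟩
    rw [← key] at hmem
    obtain ⟨j, hj, hji⟩ := hmem
    have hji' : P.root j = P.root i := by
      have : P.root j = -P.root (-i) := hji
      rw [this, root_indexNeg, neg_neg]
    rw [P.root.injective hji'] at hj
    exact hj

/-! ### The maximal root of a set of roots closed under non-orthogonality -/

/-- **A set `C` of roots, closed under `⟨α_j, α_i^∨⟩ ≠ 0, i ∈ C ⇒ j ∈ C` and non-empty, contains
a root `β` such that `β + α` is not a root for any simple root `α`.** Take `β ∈ C` with `⟨β, y⟩`
maximal. If `β + α = γ` were a root then `⟨γ, y⟩ > ⟨β, y⟩`, so `γ ∉ C`; as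
`⟨γ, β^∨⟩ = 2 + ⟨α, β^∨⟩` this forces `⟨α, β^∨⟩ = -2`, whence `α ∈ C`, and
`⟨γ, α^∨⟩ = ⟨β, α^∨⟩ + 2` forces `⟨β, α^∨⟩ = -2`; then `⟨α, β^∨⟩ ⟨β, α^∨⟩ = 4`, so `β = -α`
(finite root systems, Mathlib `coxeterWeight_eq_four_iff_not_linearIndependent`), contradicting
`⟨β, y⟩ ≥ ⟨α, y⟩ > 0`. This replaces, in Humphreys' proof of the isomorphism theorem (14.2), the
maximal root of an irreducible component. [folklore] -/
theorem exists_mem_forall_add_notMem [Finite ι] {y : Y} {C : Set ι} (hC : C.Nonempty)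
    (hcl : ∀ i ∈ C, ∀ j, P.pairing j i ≠ 0 → j ∈ C) :
    ∃ b ∈ C, ∀ a ∈ simpleRoots P y, P.root b + P.root a ∉ range P.root := by
  have _i1 : Module.IsReflexive ℤ X := .of_isPerfPair P.toLinearMap
  haveI := Fintype.ofFinite ι
  -- `b ∈ C` maximising `⟨β, y⟩`
  obtain ⟨b, hbC, hbmax⟩ := C.toFinite.exists_maximalFor (fun i => P.root' i y) C hC
  refine ⟨b, hbC, fun a ha ⟨c, hc⟩ => ?_⟩
  have hapos : 0 < P.root' a y := coweightForm_pos_of_mem_simpleRoots ha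
  -- `⟨γ, y⟩ = ⟨β, y⟩ + ⟨α, y⟩ > ⟨β, y⟩`, so `c ∉ C`
  have hcy : P.root' c y = P.root' b y + P.root' a y := by
    change P.toLinearMap (P.root c) y = P.toLinearMap (P.root b) y + P.toLinearMap (P.root a) y
    rw [hc, map_add, LinearMap.add_apply]
  have hcC : c ∉ C := by
    intro hcC
    have hle : P.root' c y ≤ P.root' b y := by
      by_contra hlt
      push Not at hlt
      exact absurd (hbmax hcC hlt.le) (not_le.mpr hlt)
    rw [hcy] at hle
    linarith
  -- `⟨γ, β^∨⟩ = 2 + ⟨α, β^∨⟩` must vanish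
  have hcb : P.pairing c b = 2 + P.pairing a b := by
    rw [← P.root_coroot_eq_pairing, hc, map_add, LinearMap.add_apply, P.root_coroot_eq_pairing,
      P.root_coroot_eq_pairing, P.pairing_same]
  have hab : P.pairing a b = -2 := by
    by_contra h
    exact hcC (hcl b hbC c (by rw [hcb]; omega))
  -- hence `a ∈ C`, and `⟨γ, α^∨⟩ = ⟨β, α^∨⟩ + 2` must vanish
  have haC : a ∈ C := hcl b hbC a (by rw [hab]; norm_num)
  have hca : P.pairing c a = P.pairing b a + 2 := by
    rw [← P.root_coroot_eq_pairing, hc, map_add, LinearMap.add_apply, P.root_coroot_eq_pairing,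
      P.root_coroot_eq_pairing, P.pairing_same]
  have hba : P.pairing b a = -2 := by
    by_contra h
    exact hcC (hcl a haC c (by rw [hca]; omega))
  -- Coxeter weight `4`: `β = -α`
  have hcox : P.coxeterWeight a b = 4 := by
    rw [RootPairing.coxeterWeight, hab, hba]; norm_num
  have hdep : ¬ LinearIndependent ℤ ![P.root a, P.root b] :=
    (P.coxeterWeight_eq_four_iff_not_linearIndependent).mp hcox
  have hsmul := P.pairing_smul_root_eq_of_not_linearIndependent hdep
  -- `⟨β, α^∨⟩ • α = 2 • β`, i.e. `-2 • α = 2 • β`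
  rw [hba] at hsmul
  have hβ : P.root b = -P.root a := by
    have h2 : (2 : ℤ) • (P.root b + P.root a) = 0 := by
      rw [smul_add, ← hsmul, neg_smul, neg_add_cancel]
    have h3 : P.root b + P.root a = 0 := by
      rcases smul_eq_zero.mp h2 with h | h
      · norm_num at h
      · exact h
    exact eq_neg_of_add_eq_zero_left h3
  -- contradiction with `⟨β, y⟩ ≥ ⟨α, y⟩ > 0`
  have hby : P.root' b y = -P.root' a y := by
    change P.toLinearMap (P.root b) y = -P.toLinearMap (P.root a) y
    rw [hβ, map_neg, LinearMap.neg_apply]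
  have hge : P.root' a y ≤ P.root' b y := by
    by_contra hlt
    push Not at hlt
    exact absurd (hbmax haC hlt.le) (not_le.mpr hlt)
  rw [hby] at hge
  linarith

/-- **Variant with positivity**: for a *regular* coweight `y`, a non-empty set `C` of roots closed
under `⟨α_j, α_i^∨⟩ ≠ 0, i ∈ C ⇒ j ∈ C` contains a `y`-*positive* root `β` with `β + α ∉ R` for
every simple `α` (in particular `β ≠ -α`). Indeed `C = -C` (as `⟨-α_i, α_i^∨⟩ = -2`), so the
maximiser of `⟨·, y⟩` over `C` used in `exists_mem_forall_add_notMem` is positive. [folklore] -/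
theorem exists_mem_pos_forall_add_notMem [Finite ι] {y : Y} (hy : ∀ i, P.root' i y ≠ 0)
    {C : Set ι} (hC : C.Nonempty) (hcl : ∀ i ∈ C, ∀ j, P.pairing j i ≠ 0 → j ∈ C) :
    ∃ b ∈ C, 0 < P.root' b y ∧ ∀ a ∈ simpleRoots P y, P.root b + P.root a ∉ range P.root := by
  -- restrict to the positive part of `C`, which is again closed and non-empty
  have _i1 : Module.IsReflexive ℤ X := .of_isPerfPair P.toLinearMap
  haveI := Fintype.ofFinite ι
  obtain ⟨b, hbC, hbmax⟩ := C.toFinite.exists_maximalFor (fun i => P.root' i y) C hC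
  have hmax : ∀ c ∈ C, P.root' c y ≤ P.root' b y := by
    intro c hcC
    by_contra hlt
    push Not at hlt
    exact absurd (hbmax hcC hlt.le) (not_le.mpr hlt)
  -- `b` is positive: either `i` or `-i` is positive, both in `C`
  have hbpos : 0 < P.root' b y := by
    obtain ⟨i, hi⟩ := hC
    rcases lt_or_gt_of_ne (hy i) with hneg | hpos
    · have hni : P.reflectionPerm i i ∈ C :=
        hcl i hi _ (by rw [P.pairing_reflectionPerm_self_left, P.pairing_same]; norm_num)
      have := hmax _ hni
      have hval : P.root' (P.reflectionPerm i i) y = -P.root' i y := by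
        change P.toLinearMap (P.root (P.reflectionPerm i i)) y = -P.toLinearMap (P.root i) y
        rw [P.root_reflectionPerm, P.reflection_apply_self, map_neg, LinearMap.neg_apply]
      rw [hval] at this
      linarith
    · exact lt_of_lt_of_le hpos (hmax i hi)
  refine ⟨b, hbC, hbpos, fun a ha ⟨c, hc⟩ => ?_⟩
  have hapos : 0 < P.root' a y := coweightForm_pos_of_mem_simpleRoots ha
  have hcy : P.root' c y = P.root' b y + P.root' a y := by
    change P.toLinearMap (P.root c) y = P.toLinearMap (P.root b) y + P.toLinearMap (P.root a) y
    rw [hc, map_add, LinearMap.add_apply]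
  have hcC : c ∉ C := fun hcC => by have := hmax c hcC; rw [hcy] at this; linarith
  have hcb : P.pairing c b = 2 + P.pairing a b := by
    rw [← P.root_coroot_eq_pairing, hc, map_add, LinearMap.add_apply, P.root_coroot_eq_pairing,
      P.root_coroot_eq_pairing, P.pairing_same]
  have hab : P.pairing a b = -2 := by
    by_contra h
    exact hcC (hcl b hbC c (by rw [hcb]; omega))
  have haC : a ∈ C := hcl b hbC a (by rw [hab]; norm_num)
  have hca : P.pairing c a = P.pairing b a + 2 := by
    rw [← P.root_coroot_eq_pairing, hc, map_add, LinearMap.add_apply, P.root_coroot_eq_pairing,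
      P.root_coroot_eq_pairing, P.pairing_same]
  have hba : P.pairing b a = -2 := by
    by_contra h
    exact hcC (hcl a haC c (by rw [hca]; omega))
  have hcox : P.coxeterWeight a b = 4 := by
    rw [RootPairing.coxeterWeight, hab, hba]; norm_num
  have hdep : ¬ LinearIndependent ℤ ![P.root a, P.root b] :=
    (P.coxeterWeight_eq_four_iff_not_linearIndependent).mp hcox
  have hsmul := P.pairing_smul_root_eq_of_not_linearIndependent hdep
  rw [hba] at hsmul
  have hβ : P.root b = -P.root a := by
    have h2 : (2 : ℤ) • (P.root b + P.root a) = 0 := by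
      rw [smul_add, ← hsmul, neg_smul, neg_add_cancel]
    have h3 : P.root b + P.root a = 0 := by
      rcases smul_eq_zero.mp h2 with h | h
      · norm_num at h
      · exact h
    exact eq_neg_of_add_eq_zero_left h3
  have hby : P.root' b y = -P.root' a y := by
    change P.toLinearMap (P.root b) y = -P.toLinearMap (P.root a) y
    rw [hβ, map_neg, LinearMap.neg_apply]
  linarith

end Literature.NumberTheory.Automorphic
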